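import Summits.QuantumFields.BalabanUV.Beta.SymBorderedHessianStepBlind
import Summits.QuantumFields.BalabanUV.Beta.AxialDressingRootedReflection
import Summits.QuantumFields.BalabanUV.Beta.CompositeCorrectorLinear

/-!
# `BalabanUV.Beta.SymRootedAveragingMatrix` — binder row D1, RULING R-D1-g35-1 (hR repair route (β) = CHART (III′)), support of brick **B1**
# (`CombChartSpreadBlind`): THE SYMMETRISED ROOTED TREE GAUGE, BLOCK POTENTIAL AND (0.4) AVERAGING ARE REPRESENTED BY THEIR MATRICES,
# THE LEGGED BORDER FUNCTIONAL `symLinAvgAt ρ` IS BLIND TO THE ROOTED COMB PROJECTOR `Π_ρ`, and THE COLUMNS OF THE ROOTED COMB DRESSING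
# `trK (piK (toSite r) N)` (unwindowed; bounded co-closed rows are reproduced; multiplier columns untouched)

HONEST FRAMING (cell charter, verbatim): «discharging `BetaPertH` makes Bałaban's UV stability UNCONDITIONAL — a real constructive-QFT
result; it is NOT the continuum limit and NOT the Clay problem.»  HONEST DEPENDENCY (verbatim): «continuum YM on T⁴ ⇐ BetaPertH ∧ nine
spine estimates (0/9 proved); BetaPertH ⇐ (D1) ∧ (D4) ∧ CAP+tail; G-an2-4 gates asym, D1 and NE2/3/4.»  THIS MODULE DISCHARGES NOTHING of
row D1 ∕ `BetaPertH`: [folklore] Form-level and kernel-column bookkeeping over OUR objects (`symTreeGaugeAt`, `SymLamAt`, `symLinAvgAt`, `axProjAt`,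
`piK`).  No `def`, no `def … : Prop`, nothing cited, 0 sorry.  NOT D1, NOT BetaPertH, NOT continuum, NOT Clay.

ABSOLUTE RULE (cell, verbatim): «No internally-minted statement may enter as a cited fact. Every hypothesis is either kernel-proved in this
package or a verbatim quotation of a PUBLISHED theorem with page reference.»

CONTENT (all [folklore]).  §1 FORM LEVEL (in-block root `toSite r`, `N ≥ 1`): **`hasSum_symTreeGaugeAt_delta1`** (`Σ'_w Σ_l symTreeGaugeAt ρ (δ_{(l,w)}) N x·A_l(w)
= symTreeGaugeAt ρ A N x`: ℝ-linearity over finite sums of scaled indicators + block locality `SymSliceBlockMatrix.symTreeGaugeAt_congr` +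
`symTreeGaugeAt_delta1_eq_zero_of_blk_ne`), **`hasSum_SymLamAt_delta1`** (`symTreeGaugeAt_block`), **`hasSum_symLinAvgAt_delta1`** (the coarse-exact
decomposition `symLinAvgAt = (d+1)!·𝒬 − dz ∘ SymLamAt` + `hasSum_contourSum_delta`), **`symLinAvgAt_axProjAt`** (`symLinAvgAt ρ (Π_ρ A) = symLinAvgAt ρ A`:
`symLinAvgAt_gauge` + `RootedComb.treeGaugeAt_root` — the Form-level heart of B1, credit an1 g49 `DshGradLegAn1.scratch` (G3) and an3 g78
`RootedBlindness.scratch`, re-proved here), `curv_axProjAt`.  §2 COLUMNS of `trK (piK (toSite r) N)`: `piK_inl_inl_eq` (the window is redundant,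
`AxialDressingRootedSupport.window_of_pm_ne_zero` + `pm_cast`), `fcol_trK_piK_inl = Π_ρ δ_{(β,z)}`, `summable_treeGaugeAt_delta1`,
**`tsum_mul_piK_inl_inl`** (a bounded co-closed row is reproduced by the field block; twin of `ValueHessianBlind.tsum_mul_piKBm_inl_inl`),
`comp_trK_piK_inr` (multiplier columns untouched), `sgnK_trK_piK`.
Unit `b2b-balaban-beta-d1-formalise-leaf-03` gen 19 (D1 formalisation swarm), 2026-08-21; row-D1 owner `b2b-balaban-beta-an2`.
-/

noncomputable section

open Finset
open scoped BigOperators Nat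
open Literature.MathematicalPhysics.QuantumFieldTheory
open Literature.MathematicalPhysics.QuantumFieldTheory.Balaban1983to89
open Literature.MathematicalPhysics.QuantumFieldTheory.Balaban1983to89.Beta
open ExpKernelCalculus (MKer comp)
open AffineAveraging (Form0 Form1 Site box toSite unitVec dz curv curvAdj codiff₁ contourSum curv_dz)
open AffineReproduction (curv_sub)
open AveragingContours (grad grad_eq_dz blk blk_block blk_add_off off off_mem_box)
open AveragingContoursRooted (ctr ctrOff ctrOff_mem_box treeGaugeAt)
open RootedComb (axProjAt treeGaugeAt_root)
open KKTFluctuationKernel (delta1 delta1_apply)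
open KKTFluctuationEnergy (summable_mul_of_bdd summable_dz)
open OneStepResolventKernel (Fib)
open Summit.QuantumFields.BalabanUV.Beta.TameKernelCalculus
open Summit.QuantumFields.BalabanUV.Beta.ResolventPermutation (P1)
open Summit.QuantumFields.BalabanUV.Beta.AxialDressingRooted (cube mem_cube bondInd pm piK piK_inl_inl piK_inl_inr piK_inr_inl piK_inr_inr
  pm_cast window_of_pm_ne_zero tsum_point' one_le_of_neZero)
open Summit.QuantumFields.BalabanUV.Beta.BorderedHessian (fcol fcol_apply sgnK sgnK_eq_self bondInd_cast_eq_delta1 treeGaugeAt_delta1_eq_zero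
  tsum_mul_dz_eq_zero_of_codiff₁ hasSum_contourSum_delta)
open Summit.QuantumFields.BalabanUV.Beta.SymmetrisedAxialPotential
open Summit.QuantumFields.BalabanUV.Beta.SymmetrisedAxialGauge (symTreeGaugeAt_block)
open Summit.QuantumFields.BalabanUV.Beta.SymSliceBlockMatrix (symTreeGaugeAt_congr symTreeGaugeAt_add symTreeGaugeAt_zero)
open Summit.QuantumFields.BalabanUV.Beta.SymBorderedHessianStepBlind (symTreeGaugeAt_delta1_eq_zero_of_blk_ne)
open Summit.QuantumFields.BalabanUV.Beta.CompositeCorrectorLinear (treeGaugeAt_smul)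

namespace Summit.QuantumFields.BalabanUV.Beta.SymRootedAveragingMatrix

variable {d : ℕ}

/-! ## §1 Form level: the symmetrised rooted objects are represented by their matrices; the legged border is blind to `Π_root` -/

section FormLevel

variable {N : ℕ} {r : Fin (d + 1) → ℕ}

/-- [folklore] **THE SYMMETRISED ROOTED TREE GAUGE IS REPRESENTED BY ITS MATRIX** (in-block root, `N ≥ 1`): for every fine 1-form `A`,
`Σ'_w Σ_l symTreeGaugeAt ρ (δ_{(l,w)}) N x · A_l(w) = symTreeGaugeAt ρ A N x` — a finite sum over the block of `x` (ℝ-linearity over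
finite sums + block locality `symTreeGaugeAt_congr` + `symTreeGaugeAt_delta1_eq_zero_of_blk_ne`). -/
theorem hasSum_symTreeGaugeAt_delta1 (hN : 1 ≤ N) (hr : r ∈ box (d + 1) N) (A : Form1 (d + 1) ℝ) (x : Fin (d + 1) → ℤ) :
    HasSum (fun w : Fin (d + 1) → ℤ => ∑ l, symTreeGaugeAt (toSite r) (delta1 l w) N x * A l w)
      (symTreeGaugeAt (toSite r) A N x) := by
  classical
  set B : Finset (Fin (d + 1) → ℤ) := (box (d + 1) N).image fun b => (N : ℤ) • blk N x + toSite b with hB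
  have hmem : ∀ w, w ∈ B ↔ blk N w = blk N x := by
    intro w
    constructor
    · intro hw
      obtain ⟨b, hb, rfl⟩ := Finset.mem_image.1 hw
      exact blk_block (blk N x) hb
    · intro hw
      exact Finset.mem_image.2 ⟨off N w, off_mem_box hN w, by rw [← hw]; exact blk_add_off hN w⟩
  -- ℝ-linearity of the symmetrised tree gauge over finite sums of scaled forms
  have hsmul : ∀ (c : ℝ) (F : Form1 (d + 1) ℝ), symTreeGaugeAt (toSite r) (c • F) N x = c * symTreeGaugeAt (toSite r) F N x := by
    intro c F
    rw [symTreeGaugeAt_eq_sum, symTreeGaugeAt_eq_sum, Finset.mul_sum]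
    refine Finset.sum_congr rfl fun σ _ => ?_
    have e : P1 σ (c • F) = c • P1 σ F := rfl
    rw [e, treeGaugeAt_smul]
  have hsum : ∀ (s : Finset ((Fin (d + 1) → ℤ) × Fin (d + 1))) (F : (Fin (d + 1) → ℤ) × Fin (d + 1) → Form1 (d + 1) ℝ),
      symTreeGaugeAt (toSite r) (∑ p ∈ s, F p) N x = ∑ p ∈ s, symTreeGaugeAt (toSite r) (F p) N x := by
    intro s F
    induction s using Finset.induction_on with
    | empty => rw [Finset.sum_empty, Finset.sum_empty, symTreeGaugeAt_zero]
    | insert i s hi ih => rw [Finset.sum_insert hi, Finset.sum_insert hi, symTreeGaugeAt_add, ih]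
  -- the truncation of `A` to the block of `x`, as a finite sum of scaled bond indicators
  set A' : Form1 (d + 1) ℝ := ∑ p ∈ B ×ˢ (Finset.univ : Finset (Fin (d + 1))), A p.2 p.1 • delta1 p.2 p.1 with hA'
  have hA'ap : ∀ κ z, A' κ z = if z ∈ B then A κ z else 0 := by
    intro κ z
    rw [hA', Finset.sum_apply, Finset.sum_apply]
    have e : ∀ p : (Fin (d + 1) → ℤ) × Fin (d + 1), (A p.2 p.1 • delta1 p.2 p.1) κ z = if (z, κ) = p then A κ z else 0 := by
      rintro ⟨w, l⟩
      rw [Pi.smul_apply, Pi.smul_apply, smul_eq_mul, delta1_apply]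
      by_cases h : (z, κ) = (w, l)
      · obtain ⟨rfl, rfl⟩ := Prod.mk.inj h
        rw [if_pos ⟨rfl, rfl⟩, if_pos rfl, mul_one]
      · rw [if_neg h, if_neg, mul_zero]
        rintro ⟨hκ, hz⟩
        exact h (by rw [hκ, hz])
    simp_rw [e]
    rw [Finset.sum_ite_eq]
    simp only [Finset.mem_product, Finset.mem_univ, and_true]
  have hcongr : symTreeGaugeAt (toSite r) A N x = symTreeGaugeAt (toSite r) A' N x :=
    symTreeGaugeAt_congr hN hr fun κ z hz _ => by rw [hA'ap, if_pos ((hmem z).2 hz)]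
  have hzero : ∀ w ∉ B, ∑ l, symTreeGaugeAt (toSite r) (delta1 l w) N x * A l w = 0 := by
    intro w hw
    refine Finset.sum_eq_zero fun l _ => ?_
    rw [symTreeGaugeAt_delta1_eq_zero_of_blk_ne hN hr (fun h => hw ((hmem w).2 h.symm)), zero_mul]
  have hval : ∑ w ∈ B, ∑ l, symTreeGaugeAt (toSite r) (delta1 l w) N x * A l w = symTreeGaugeAt (toSite r) A N x := by
    rw [hcongr, hA', hsum, Finset.sum_product]
    refine Finset.sum_congr rfl fun w _ => Finset.sum_congr rfl fun l _ => ?_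
    rw [hsmul, mul_comm]
  rw [← hval]
  exact hasSum_sum_of_ne_finset_zero hzero

/-- [folklore] **THE SYMMETRISED BLOCK POTENTIAL IS REPRESENTED BY ITS MATRIX**: `Σ'_w Σ_l SymLamAt ρ (δ_{(l,w)}) N Y · A_l(w) = SymLamAt ρ A N Y`
(a finite sum of tree gauges over the block `Y`, `symTreeGaugeAt_block`). -/
theorem hasSum_SymLamAt_delta1 (hN : 1 ≤ N) (hr : r ∈ box (d + 1) N) (A : Form1 (d + 1) ℝ) (Y : Fin (d + 1) → ℤ) :
    HasSum (fun w : Fin (d + 1) → ℤ => ∑ l, SymLamAt (toSite r) (delta1 l w) N Y * A l w) (SymLamAt (toSite r) A N Y) := by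
  have e : ∀ F : Form1 (d + 1) ℝ,
      SymLamAt (toSite r) F N Y = ∑ b ∈ box (d + 1) N, symTreeGaugeAt (toSite r) F N ((N : ℤ) • Y + toSite b) := by
    intro F
    rw [SymLamAt]
    exact Finset.sum_congr rfl fun b hb => (symTreeGaugeAt_block r F Y hb).symm
  have key : ∀ w, ∑ l, SymLamAt (toSite r) (delta1 l w) N Y * A l w
      = ∑ b ∈ box (d + 1) N, ∑ l, symTreeGaugeAt (toSite r) (delta1 l w) N ((N : ℤ) • Y + toSite b) * A l w := by
    intro w
    simp_rw [e, Finset.sum_mul]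
    exact Finset.sum_comm
  simp_rw [key]
  rw [e]
  exact hasSum_sum fun b _ => hasSum_symTreeGaugeAt_delta1 hN hr A _

/-- [folklore] **THE (0.4)-SYMMETRISED ROOTED AVERAGING IS REPRESENTED BY ITS MATRIX**: for every fine 1-form `A`,
`Σ'_w Σ_l symLinAvgAt ρ (δ_{(l,w)}) N m Y · A_l(w) = symLinAvgAt ρ A N m Y` — by the coarse-exact decomposition
`symLinAvgAt = (d+1)!·𝒬 − dz ∘ SymLamAt` (`symLinAvgAt_eq_contourSum_sub_dz`), `hasSum_contourSum_delta` and `hasSum_SymLamAt_delta1`. -/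
theorem hasSum_symLinAvgAt_delta1 (hN : 1 ≤ N) (hr : r ∈ box (d + 1) N) (A : Form1 (d + 1) ℝ) (m : Fin (d + 1))
    (Y : Fin (d + 1) → ℤ) :
    HasSum (fun w : Fin (d + 1) → ℤ => ∑ l, symLinAvgAt (toSite r) (delta1 l w) N m Y * A l w)
      (symLinAvgAt (toSite r) A N m Y) := by
  have key : ∀ F : Form1 (d + 1) ℝ, symLinAvgAt (toSite r) F N m Y
      = ((d + 1) ! : ℝ) * contourSum N F m Y - (SymLamAt (toSite r) F N (Y + unitVec m) - SymLamAt (toSite r) F N Y) :=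
    fun F => symLinAvgAt_eq_contourSum_sub_dz _ _ _ _ _
  have h := ((hasSum_contourSum_delta N A m Y).mul_left ((d + 1) ! : ℝ)).sub
    ((hasSum_SymLamAt_delta1 hN hr A (Y + unitVec m)).sub (hasSum_SymLamAt_delta1 hN hr A Y))
  have hfun : (fun w : Fin (d + 1) → ℤ => ∑ l, symLinAvgAt (toSite r) (delta1 l w) N m Y * A l w)
      = fun w => ((d + 1) ! : ℝ) * (∑ l, contourSum N (delta1 l w) m Y * A l w)
        - ((∑ l, SymLamAt (toSite r) (delta1 l w) N (Y + unitVec m) * A l w)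
          - ∑ l, SymLamAt (toSite r) (delta1 l w) N Y * A l w) := by
    funext w
    simp only [key, sub_mul, Finset.sum_sub_distrib, Finset.mul_sum, mul_assoc]
  rw [key, hfun]
  exact h

/-- [folklore] **THE LEGGED BORDER IS BLIND TO THE ROOTED COMB PROJECTOR** (in-block root; Form-level heart of B1 — an1 g49 (G3) ∕ an3 g78
(B1-core), re-proved): `symLinAvgAt ρ (Π_ρ A) N μ y = symLinAvgAt ρ A N μ y`.  `Π_ρ A = A − grad λ^ρ_A` and the symmetrised rooted
averaging of an exact form reads `λ` at the block ROOTS only (`symLinAvgAt_gauge`), where `λ^ρ_A` vanishes (`treeGaugeAt_root`). -/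
theorem symLinAvgAt_axProjAt (hr : r ∈ box (d + 1) N) (A : Form1 (d + 1) ℝ) (μ : Fin (d + 1)) (y : Fin (d + 1) → ℤ) :
    symLinAvgAt (toSite r) (axProjAt (toSite r) N A) N μ y = symLinAvgAt (toSite r) A N μ y := by
  have hc : (N : ℤ) • y + toSite r + (N : ℤ) • unitVec μ = (N : ℤ) • (y + unitVec μ) + toSite r := by
    rw [smul_add]; abel
  rw [axProjAt, symLinAvgAt_gauge, hc, treeGaugeAt_root hr A, treeGaugeAt_root hr A, sub_self, mul_zero, sub_zero]

/-- [folklore] `curv (Π_ρ A) = curv A` — the rooted comb dressing is a gradient correction, killed by `curv`. -/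
theorem curv_axProjAt (ρ : Fin (d + 1) → ℤ) (N : ℕ) (A : Form1 (d + 1) ℝ) : curv (axProjAt ρ N A) = curv A := by
  rw [axProjAt, curv_sub, grad_eq_dz, curv_dz, sub_zero]

end FormLevel

/-! ## §2 The columns of the rooted comb dressing `trK (piK (toSite r) N)` -/

section Columns

variable {N : ℕ} {r : Fin (d + 1) → ℕ}

/-- [folklore] The (windowed) matrix entry of `piK` IS the matrix of `Π_ρ` (in-block root; the window is redundant by
`window_of_pm_ne_zero`): `piK ρ N z y (inl β) (inl l) = (Π_ρ δ_{(β,z)})_l(y)`. -/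
theorem piK_inl_inl_eq (hN : 1 ≤ N) (hr : r ∈ box (d + 1) N) (z y : Fin (d + 1) → ℤ) (β l : Fin (d + 1)) :
    piK (toSite r) N z y (Sum.inl β) (Sum.inl l) = axProjAt (toSite r) N (delta1 β z) l y := by
  rw [piK_inl_inl, ← bondInd_cast_eq_delta1, ← pm_cast]
  split_ifs with h
  · rfl
  · by_contra hne
    exact h (window_of_pm_ne_zero hN hr fun e => hne (by rw [e, Int.cast_zero]))

/-- [folklore] **THE FIELD COLUMN OF `trK piK` AT `(inl β, z)` IS `Π_ρ δ_{(β,z)}`.** -/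
theorem fcol_trK_piK_inl (hN : 1 ≤ N) (hr : r ∈ box (d + 1) N) (z : Fin (d + 1) → ℤ) (β : Fin (d + 1)) :
    fcol (trK (piK (toSite r) N)) z (Sum.inl β) = axProjAt (toSite r) N (delta1 β z) := by
  funext l y
  rw [fcol_apply, trK_apply, piK_inl_inl_eq hN hr]

/-- [folklore] The rooted tree gauge of a bond indicator is summable (finitely supported, `treeGaugeAt_delta1_eq_zero`). -/
theorem summable_treeGaugeAt_delta1 (hN : 1 ≤ N) (hr : r ∈ box (d + 1) N) (β : Fin (d + 1)) (z : Fin (d + 1) → ℤ) :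
    Summable (treeGaugeAt (toSite r) (delta1 β z) N) := by
  refine summable_of_ne_finset_zero (s := Fintype.piFinset fun j : Fin (d + 1) => Finset.Icc (z j - N) (z j + N))
    fun p hp => ?_
  rw [Fintype.mem_piFinset] at hp
  obtain ⟨j, hj⟩ := not_forall.mp hp
  rw [Finset.mem_Icc, not_and_or, not_le, not_le] at hj
  apply treeGaugeAt_delta1_eq_zero hN hr (j := j)
  rw [le_abs]
  rcases hj with h | h
  · right; linarith
  · left; linarith

/-- [folklore] **REPRODUCTION OF A BOUNDED CO-CLOSED ROW BY THE FIELD BLOCK OF `trK piK`** (in-block root; twin of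
`ValueHessianBlind.tsum_mul_piKBm_inl_inl`): `Σ'_y Σ_l A_l(y) · piK ρ N z y (inl β) (inl l) = A_β(z)` — the column is `δ_{(β,z)} − d λ`
and the exact part pairs to zero with `A` (`tsum_mul_dz_eq_zero_of_codiff₁`). -/
theorem tsum_mul_piK_inl_inl (hN : 1 ≤ N) (hr : r ∈ box (d + 1) N) {A : Form1 (d + 1) ℝ} {C : ℝ}
    (hA : ∀ l y, |A l y| ≤ C) (hco : codiff₁ A = 0) (z : Fin (d + 1) → ℤ) (β : Fin (d + 1)) :
    ∑' y, ∑ l, A l y * piK (toSite r) N z y (Sum.inl β) (Sum.inl l) = A β z := by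
  have e : ∀ (y : Fin (d + 1) → ℤ) (l : Fin (d + 1)), piK (toSite r) N z y (Sum.inl β) (Sum.inl l) =
      delta1 β z l y - dz (treeGaugeAt (toSite r) (delta1 β z) N) l y := by
    intro y l
    rw [piK_inl_inl_eq hN hr, axProjAt, grad_eq_dz]
    rfl
  simp_rw [e, mul_sub, Finset.sum_sub_distrib]
  have hδ : ∀ y, y ≠ z → ∑ l, A l y * delta1 β z l y = 0 := fun y hy =>
    Finset.sum_eq_zero fun l _ => by rw [delta1_apply, if_neg (fun h => hy h.2), mul_zero]
  have hs1 : Summable fun y => ∑ l, A l y * delta1 β z l y :=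
    summable_of_ne_finset_zero (s := {z}) fun y hy => hδ y (by rwa [Finset.mem_singleton] at hy)
  have hg := summable_treeGaugeAt_delta1 hN hr β z
  have hs2 : Summable fun y => ∑ l, A l y * dz (treeGaugeAt (toSite r) (delta1 β z) N) l y :=
    summable_sum fun l _ => summable_mul_of_bdd (hA l) (summable_dz hg l)
  rw [hs1.tsum_sub hs2, tsum_mul_dz_eq_zero_of_codiff₁ hA hco hg, sub_zero, tsum_eq_single z hδ,
    Finset.sum_eq_single β (fun l _ hl => by rw [delta1_apply, if_neg (fun h => hl h.1), mul_zero])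
      (fun h => (h (Finset.mem_univ β)).elim),
    delta1_apply, if_pos ⟨rfl, rfl⟩, mul_one]

/-- [folklore] Right composition with `trK piK` does not touch a MULTIPLIER column (the multiplier block of `piK` is the identity, the mixed
blocks vanish). -/
theorem comp_trK_piK_inr (ρ : Fin (d + 1) → ℤ) (N : ℕ) (A : MKer (d + 1) (Fib d)) (x z : Fin (d + 1) → ℤ) (a : Fib d)
    (μ : Fin (d + 1)) : comp A (trK (piK ρ N)) x z a (Sum.inr μ) = A x z a (Sum.inr μ) := by
  unfold ExpKernelCalculus.comp
  have h : ∀ y, ∑ f : Fib d, A x y a f * trK (piK ρ N) y z f (Sum.inr μ) = if y = z then A x y a (Sum.inr μ) else 0 := by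
    intro y
    rw [Fintype.sum_sum_type]
    simp only [trK_apply, piK_inr_inl, mul_zero, Finset.sum_const_zero, zero_add, piK_inr_inr]
    by_cases hy : y = z
    · subst hy
      simp
    · simp [hy, Ne.symm hy]
  simp_rw [h]
  exact tsum_point' z _

/-- [folklore] `piK` has vanishing mixed blocks, so `sgnK` fixes its transpose. -/
theorem sgnK_trK_piK (ρ : Fin (d + 1) → ℤ) (N : ℕ) : sgnK (trK (piK ρ N)) = trK (piK (d := d) ρ N) :=
  sgnK_eq_self (fun x y κ l => by rw [trK_apply, piK_inr_inl]) (fun x y κ l => by rw [trK_apply, piK_inl_inr])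

end Columns

end Summit.QuantumFields.BalabanUV.Beta.SymRootedAveragingMatrix

end
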